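import Mathlib
import HarnessLib
import Summits.AtomisticToContinuum.FouriersLaw.Theses.VanishingNoiseTransfer
import Summits.AtomisticToContinuum.FouriersLaw.Theorems.VanishingNoiseTransferNoisyFourierFlipConductanceCeiling
import Literature.MathematicalPhysics.KineticTheory.VelocityFlipNoise

/-!
# `VanishingNoiseBound` from an ε-uniform BULK FIELD CEILING, and the ceiling from a bulk per-bond bound
(crux `VanishingNoiseTransfer.VanishingNoiseBound`, item stmt-AtomisticToContinuum-11976; line
`energy-dipole-leak-coercivity`, lead a2; `--supports` file — nothing here closes the item)

The OPERATIONAL FORM of the crux in the finite-`N` bath frame. Along the unique flip-steady family at rate `ε` the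
tree supplies, at every length `N ≥ 2`, a classical `C²`, `e^{H/4T}`-bounded dual forward field `g` of
`(L_{T,T} + εS) g = −(p_0² − T)` (`NoisyFourier.FlipPositiveConductance.dualForwardFields_of_mild_hypo_upgrade_cont` fed
by the four landed `VanishingNoiseBound.stub_flip*` theorems) together with the Kubo link
`D_N/(N−1) = γ(1 − (γ/T²)⟨g, p_0² − T⟩_{μ_T})` (`VanishingNoiseBound.flip_kuboLink_of_dualForwardFields`). Hence:

* `vanishingNoiseBound_of_bulkFieldCeiling` — if for all parameters `> 0` and `T > 0` there is ONE `K` such that for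
  every `ε ∈ (0, 1]` there is a length `L₀` (allowed to depend on `ε`) beyond which every classical forward field of the
  `ε`-problem has `(L − 1)·γ(1 − (γ/T²)⟨g, p_0² − T⟩_{μ_T}) ≤ K`, then `VanishingNoiseBound` holds (`ε₁ = 1`,
  `le_of_tendsto`). Compared with the landed `NoisyFourier.FlipCeiling.fieldCeiling_of` (`K = M/(2εT²)`, Bernardin–Olla's
  `O(1/ε)` line) the whole content of the crux is the `ε`-uniformity of `K`; compared with the v1 skeleton of the line
  (`UniformFieldCeiling`, `L₀` uniform in `ε`, which carries `BoundedResponse` = stmt-11071 strength) the `ε`-dependence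
  of `L₀` is exactly the slack the crux — a statement about `lim_N D_N(ε)` at fixed `ε` — allows.
* `bulkFieldCeiling_of_bulkBondBound` — the ceiling follows from any per-bond bound in the BULK,
  `(∫ g j_i dμ_T)² ≤ C·ε·Σ_{x ∈ [i−ℓ, i+1+ℓ]} ‖g∘F_x − g‖²` for the bonds at distance `≥ r(ε)` from the baths, with `C`
  uniform in `ε`: summing over the bulk bonds against the landed flip budget `(ε/2)Σ_x‖g∘F_x − g‖² ≤ T²/γ − A`
  (`helper_flipFieldDissipationLe`) and the bond identity `∫ g j_i = γA − T²` (`helper_flipBondResponseIdentity`) the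
  flip RATE CANCELS: `K = 4C(2ℓ+2)/T²`, `L₀(ε) = 4ℓ + 4r(ε) + 8`. (This is the composition of the line's skeleton v2,
  `Cruxes/VanishingNoiseBound/Lines/energy_dipole_leak_coercivity.lean`; its registered stub `stub_bulkTwoChannel` is the
  hypothesis `hB` verbatim. HONEST SIZE of that hypothesis: its best constant is `C ≍ T²κ_ε(T)/(2(2ℓ+2))`, so
  `ε`-uniformity of `C` is the crux's own content.)

No definitions; axioms `propext`, `Classical.choice`, `Quot.sound` only. References: Bernardin–Olla 2011 §3 (entropy
production bound, Prop. 4); Bernardin–Huveneers–Lebowitz–Liverani–Olla 2015 §1 (the open question of `ε`-uniformity).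
-/

noncomputable section

open MeasureTheory Filter Topology Finset
open Literature.MathematicalPhysics.KineticTheory.HeatConduction
open Summit.AtomisticToContinuum.FouriersLaw.Theorems
open Summit.AtomisticToContinuum.FouriersLaw.Theorems.SuperadditiveResistance.DeviceLiouville (kin)
open Summit.AtomisticToContinuum.FouriersLaw.Cruxes.ConductanceLowerBound.ForecastSensitivity
  (memLp_two_of_abs_le_exp)

namespace Summit.AtomisticToContinuum.FouriersLaw.Theorems.VanishingNoiseBound

/-! ## The crux from an ε-uniform bulk field ceiling -/

section Ceiling

/-- **`VanishingNoiseBound` from an ε-uniform bulk field ceiling.** If for all parameters `> 0` and `T > 0` there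
is `K` such that for every `ε ∈ (0, 1]` there is `L₀` with `(L − 1)·γ(1 − (γ/T²)⟨g, p_0² − T⟩_{μ_T}) ≤ K` for every
`L ≥ max(L₀, 2)` and every classical `C²`, `e^{H/4T}`-bounded forward field `g` of `(L_{T,T} + εS) g = −(p_0² − T)`,
then the crux holds with that `K` and `ε₁ = 1`: along the unique flip-steady family the landed dual forward fields and
Kubo link give `D_N(ε) ≤ K` for `N ≥ max(L₀(ε), 2)`, and `k = lim_N D_N ≤ K`. [cite: BernardinOlla2011, §3] -/
theorem vanishingNoiseBound_of_bulkFieldCeiling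
    (hU : ∀ (ω₂ lam β γ T : ℝ), 0 < ω₂ → 0 < lam → 0 < β → 0 < γ → 0 < T →
      ∃ K : ℝ, ∀ ε : ℝ, 0 < ε → ε ≤ 1 → ∃ L₀ : ℕ, ∀ (L : ℕ), L₀ ≤ L → 2 ≤ L →
        ∀ g : PhaseSpace L → ℝ, ContDiff ℝ 2 g →
          (∃ C₀ : ℝ, ∀ u, |g u| ≤ C₀ * Real.exp (1 / (4 * T) * (pinnedChain ω₂ lam β γ).hamiltonian L u)) →
          (∀ u, (pinnedChain ω₂ lam β γ).flipGenerator L T T ε g u = -(kin L 0 u - T)) →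
          ((L : ℝ) - 1) * (γ * (1 - γ / T ^ 2 *
            ∫ u, g u * (kin L 0 u - T) ∂((pinnedChain ω₂ lam β γ).gibbsMeasure L T))) ≤ K) :
    Theses.VanishingNoiseTransfer.VanishingNoiseBound := by
  intro ω₂ lam β γ hω hl hβ hγ S hS T hT
  subst hS
  obtain ⟨K, hK⟩ := hU ω₂ lam β γ T hω hl hβ hγ hT
  refine ⟨K, 1, one_pos, ?_⟩
  intro ε hε hε1 μ hμ' D k hD hk
  obtain ⟨L₀, hKε⟩ := hK ε hε hε1
  have hFF := NoisyFourier.FlipPositiveConductance.dualForwardFields_of_mild_hypo_upgrade_cont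
      Theorems.VanishingNoiseBound.stub_flipMildDistributional Theorems.VanishingNoiseBound.stub_flipHypoelliptic
      Theorems.VanishingNoiseBound.stub_flipSmoothMildUpgrade Theorems.VanishingNoiseBound.stub_flipMildContinuity
  have hev : ∀ᶠ N in atTop, D N ≤ K := by
    refine Filter.eventually_atTop.2 ⟨max L₀ 2, fun N hN => ?_⟩
    have hN2 : 2 ≤ N := le_trans (le_max_right _ _) hN
    have hNL : L₀ ≤ N := le_trans (le_max_left _ _) hN
    obtain ⟨g, δ₀, hδ₀, hC, hpde, hbd, hweak, hlim0, hlim1⟩ :=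
      hFF ω₂ lam β γ T ε hω hl hβ hγ hT hε μ hμ' N hN2
    obtain ⟨C₀, hgb0⟩ := hbd 0 (by simpa using hδ₀)
    have hlink := Theorems.VanishingNoiseBound.flip_kuboLink_of_dualForwardFields μ D hω hl hβ hγ hT hε hμ' hN2
      (hD N) g hδ₀ (fun δ h0 h1 => ((hweak δ h0 h1).1).aestronglyMeasurable) (fun δ _ h1 => hbd δ h1)
      (fun δ h0 h1 => (hweak δ h0 h1).2) hlim0 hlim1 hC hgb0 hpde
    have hb := hKε N hNL hN2 (g 0) hC ⟨C₀, hgb0⟩ hpde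
    rw [← hlink] at hb
    have hN1 : 0 < (N : ℝ) - 1 := by
      have : (2 : ℝ) ≤ (N : ℝ) := by exact_mod_cast hN2
      linarith
    rwa [mul_div_cancel₀ _ hN1.ne'] at hb
  exact le_of_tendsto hk hev

end Ceiling

/-! ## The bulk field ceiling from a bulk per-bond bound: the flip rate cancels -/

section PerBond

/-- **Bulk per-bond bound ⟹ ε-uniform bulk field ceiling.** If `ℓ, C ≥ 0` are such that for every `ε ∈ (0,1]`
there is an exclusion radius `r` with `(∫ g j_i dμ_T)² ≤ C·ε·Σ_{x ∈ [i−ℓ, i+1+ℓ]} ∫ (g∘F_x − g)² dμ_T` for every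
`L ≥ 2`, every classical `C²`, `e^{H/4T}`-bounded forward field `g` of the `ε`-problem and every bond `i` with
`r + ℓ + 1 ≤ i`, `i + ℓ + r + 3 ≤ L`, then the bulk field ceiling holds with `K = 4C(2ℓ+2)/T²` and
`L₀(ε) = 4ℓ + 4r(ε) + 8`: sum over the `L − 2ℓ − 2r − 4 ≥ (L−1)/2` bulk bonds, double-count windows, insert the
bond identity `∫ g j_i = γA − T²` and the flip budget `(ε/2)Σ_x ∫ (g∘F_x − g)² ≤ T²/γ − A`; the rate cancels.
[cite: BernardinOlla2011, §3] -/
theorem bulkFieldCeiling_of_bulkBondBound {ω₂ lam β γ T : ℝ} (hω : 0 < ω₂) (hl : 0 < lam) (hβ : 0 < β)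
    (hγ : 0 < γ) (hT : 0 < T) {ℓ : ℕ} {C : ℝ} (hC0 : 0 ≤ C)
    (hB : ∀ ε : ℝ, 0 < ε → ε ≤ 1 → ∃ r : ℕ,
        ∀ (L : ℕ), 2 ≤ L → ∀ g : PhaseSpace L → ℝ, ContDiff ℝ 2 g →
        (∃ C₀ : ℝ, ∀ u, |g u| ≤ C₀ * Real.exp (1 / (4 * T) * (pinnedChain ω₂ lam β γ).hamiltonian L u)) →
        (∀ u, (pinnedChain ω₂ lam β γ).flipGenerator L T T ε g u = -(kin L 0 u - T)) →
        ∀ i : Fin L, r + ℓ + 1 ≤ i.val → i.val + ℓ + r + 3 ≤ L →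
        (∫ u, g u * (pinnedChain ω₂ lam β γ).bondCurrent L i u
            ∂((pinnedChain ω₂ lam β γ).gibbsMeasure L T)) ^ 2 ≤
          C * ε * ∑ x : Fin L, if i.val - ℓ ≤ x.val ∧ x.val ≤ i.val + 1 + ℓ then
              ∫ u, (g (momentumFlip x u) - g u) ^ 2 ∂((pinnedChain ω₂ lam β γ).gibbsMeasure L T) else 0) :
    ∀ ε : ℝ, 0 < ε → ε ≤ 1 → ∃ L₀ : ℕ, ∀ (L : ℕ), L₀ ≤ L → 2 ≤ L →
      ∀ g : PhaseSpace L → ℝ, ContDiff ℝ 2 g →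
        (∃ C₀ : ℝ, ∀ u, |g u| ≤ C₀ * Real.exp (1 / (4 * T) * (pinnedChain ω₂ lam β γ).hamiltonian L u)) →
        (∀ u, (pinnedChain ω₂ lam β γ).flipGenerator L T T ε g u = -(kin L 0 u - T)) →
        ((L : ℝ) - 1) * (γ * (1 - γ / T ^ 2 *
          ∫ u, g u * (kin L 0 u - T) ∂((pinnedChain ω₂ lam β γ).gibbsMeasure L T))) ≤
            4 * C * ((2 * ℓ + 2 : ℕ) : ℝ) / T ^ 2 := by
  -- adapted from the composition `uniformFieldCeiling_of` of the line's skeleton v1 (planner crux-plan / lead a1),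
  -- bulk bonds only, ε-dependent `L₀`
  set w : ℕ := 2 * ℓ + 2 with hw
  intro ε hε hε1
  obtain ⟨r, Hr⟩ := hB ε hε hε1
  refine ⟨4 * ℓ + 4 * r + 8, ?_⟩
  intro L hL0 hL2 g hg2 hgb hpde
  set P := pinnedChain ω₂ lam β γ with hP
  set μ := P.gibbsMeasure L T with hμ
  obtain ⟨C₀, hC₀⟩ := hgb
  have h14' : 2 * (1 / (4 * T)) < 1 / T := by
    rw [show 2 * (1 / (4 * T)) = 1 / (2 * T) by field_simp; ring, div_lt_div_iff₀ (by positivity) hT]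
    nlinarith
  have hgL : MemLp g 2 μ := memLp_two_of_abs_le_exp hω hl.le hβ.le γ L hT h14' hg2.continuous hC₀
  -- landed identities of the forward field
  set A := ∫ u, g u * (kin L 0 u - T) ∂μ with hA
  set Bh := T ^ 2 / γ - A with hBh
  set d : Fin L → ℝ := fun x => ∫ u, (g (momentumFlip x u) - g u) ^ 2 ∂μ with hd
  have hd0 : ∀ x, 0 ≤ d x := fun x => integral_nonneg fun u => sq_nonneg _
  have hdiss : ε / 2 * ∑ x, d x ≤ Bh :=
    NoisyFourier.FlipCeiling.helper_flipFieldDissipationLe ω₂ lam β γ T ε hω hl hβ hγ hT L hL2 g hg2 hgL hpde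
  have hE0 : 0 ≤ ∑ x, d x := Finset.sum_nonneg fun x _ => hd0 x
  have hBh0 : 0 ≤ Bh := le_trans (by positivity) hdiss
  have hεE : ε * ∑ x, d x ≤ 2 * Bh := by linarith
  have hbond : ∀ i : Fin L, i.val + 1 < L → ∫ u, g u * P.bondCurrent L i u ∂μ = γ * A - T ^ 2 :=
    fun i hi => NoisyFourier.FlipCeiling.helper_flipBondResponseIdentity ω₂ lam β γ T ε hω hl hβ hγ hT L hL2 g
      hg2 hgL hpde i hi
  -- window cardinalities
  have hcardW : ∀ lo hi : ℕ,
      (Finset.univ.filter (fun x : Fin L => lo ≤ x.val ∧ x.val ≤ hi)).card ≤ hi + 1 - lo := by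
    intro lo hi
    calc (Finset.univ.filter (fun x : Fin L => lo ≤ x.val ∧ x.val ≤ hi)).card
        ≤ (Finset.Icc lo hi).card := by
          refine Finset.card_le_card_of_injOn (fun x => x.val) ?_ ?_
          · intro x hx
            rw [Finset.mem_coe, Finset.mem_filter] at hx
            rw [Finset.mem_coe, Finset.mem_Icc]
            exact hx.2
          · intro x _ y _ hxy
            exact Fin.ext hxy
      _ = hi + 1 - lo := Nat.card_Icc lo hi
  -- per bulk bond: the hypothesis, rewritten with the bond identity
  have hperbond : ∀ i : Fin L, r + ℓ + 1 ≤ i.val → i.val + ℓ + r + 3 ≤ L →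
      (γ * Bh) ^ 2 ≤ C * ε * ∑ x : Fin L, if i.val - ℓ ≤ x.val ∧ x.val ≤ i.val + 1 + ℓ then d x else 0 := by
    intro i hi1 hi2
    have hmain := Hr L hL2 g hg2 ⟨C₀, hC₀⟩ hpde i hi1 hi2
    have hbondi : ∫ u, g u * P.bondCurrent L i u ∂μ = γ * A - T ^ 2 := hbond i (by omega)
    have e1 : (γ * Bh) ^ 2 = (∫ u, g u * P.bondCurrent L i u ∂μ) ^ 2 := by
      rw [hbondi, hBh]; field_simp; ring
    rw [e1]
    exact hmain
  -- the bulk bonds `i = n + r + ℓ + 1`, `n < m := L - 2ℓ - 2r - 4`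
  set m : ℕ := L - 2 * ℓ - 2 * r - 4 with hm
  have hmL : ∀ n, n < m → n + r + ℓ + 1 < L := by
    intro n hn; omega
  let emb : Fin m → Fin L := fun n => ⟨n.val + r + ℓ + 1, hmL n.val n.isLt⟩
  have hemb : Function.Injective emb := by
    intro a b hab
    apply Fin.ext
    have h := congrArg Fin.val hab
    simp only [emb] at h
    omega
  set I : Finset (Fin L) := Finset.univ.image emb with hI
  have hIcard : I.card = m := by
    rw [hI, Finset.card_image_of_injective _ hemb, Finset.card_univ, Fintype.card_fin]
  have hImem : ∀ i ∈ I, r + ℓ + 1 ≤ i.val ∧ i.val + ℓ + r + 3 ≤ L := by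
    intro i hi
    rw [hI, Finset.mem_image] at hi
    obtain ⟨n, _, rfl⟩ := hi
    have hn := n.isLt
    simp only [emb]
    constructor <;> omega
  have hsumI : (m : ℝ) * (γ * Bh) ^ 2 ≤ C * ε *
      ∑ i ∈ I, ∑ x : Fin L, if i.val - ℓ ≤ x.val ∧ x.val ≤ i.val + 1 + ℓ then d x else 0 := by
    have h := Finset.sum_le_sum fun i hi => hperbond i (hImem i hi).1 (hImem i hi).2
    rw [Finset.sum_const, hIcard, nsmul_eq_mul, ← Finset.mul_sum] at h
    exact h
  have hcount : (∑ i ∈ I, ∑ x : Fin L, if i.val - ℓ ≤ x.val ∧ x.val ≤ i.val + 1 + ℓ then d x else 0)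
      ≤ (w : ℝ) * ∑ x : Fin L, d x := by
    rw [Finset.sum_comm, Finset.mul_sum]
    refine Finset.sum_le_sum fun x _ => ?_
    have hsub : ∀ i ∈ I, (if i.val - ℓ ≤ x.val ∧ x.val ≤ i.val + 1 + ℓ then d x else 0) ≤
        if (x.val - (ℓ + 1) ≤ i.val ∧ i.val ≤ x.val + ℓ) then d x else 0 := by
      intro i _
      by_cases h : i.val - ℓ ≤ x.val ∧ x.val ≤ i.val + 1 + ℓ
      · have h' : x.val - (ℓ + 1) ≤ i.val ∧ i.val ≤ x.val + ℓ := by omega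
        rw [if_pos h, if_pos h']
      · rw [if_neg h]
        split_ifs
        exacts [hd0 x, le_rfl]
    calc (∑ i ∈ I, if i.val - ℓ ≤ x.val ∧ x.val ≤ i.val + 1 + ℓ then d x else 0)
        ≤ ∑ i ∈ I, if (x.val - (ℓ + 1) ≤ i.val ∧ i.val ≤ x.val + ℓ) then d x else 0 :=
          Finset.sum_le_sum hsub
      _ ≤ ∑ i : Fin L, if (x.val - (ℓ + 1) ≤ i.val ∧ i.val ≤ x.val + ℓ) then d x else 0 := by
          refine Finset.sum_le_sum_of_subset_of_nonneg (Finset.subset_univ I) ?_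
          intro i _ _
          split_ifs
          exacts [hd0 x, le_rfl]
      _ = ((Finset.univ.filter (fun i : Fin L => x.val - (ℓ + 1) ≤ i.val ∧ i.val ≤ x.val + ℓ)).card : ℝ)
            * d x := by
          rw [Finset.sum_ite, Finset.sum_const_zero, add_zero, Finset.sum_const, nsmul_eq_mul]
      _ ≤ (w : ℝ) * d x := by
          refine mul_le_mul_of_nonneg_right ?_ (hd0 x)
          have hc := hcardW (x.val - (ℓ + 1)) (x.val + ℓ)
          have hw' : x.val + ℓ + 1 - (x.val - (ℓ + 1)) ≤ w := by omega
          exact_mod_cast hc.trans hw'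
  have hmain2 : (m : ℝ) * (γ * Bh) ^ 2 ≤ 2 * C * (w : ℝ) * Bh := by
    have hCε : 0 ≤ C * ε := by positivity
    calc (m : ℝ) * (γ * Bh) ^ 2 ≤ C * ε * ((w : ℝ) * ∑ x : Fin L, d x) :=
          hsumI.trans (mul_le_mul_of_nonneg_left hcount hCε)
      _ = C * (w : ℝ) * (ε * ∑ x : Fin L, d x) := by ring
      _ ≤ C * (w : ℝ) * (2 * Bh) := mul_le_mul_of_nonneg_left hεE (by positivity)
      _ = 2 * C * (w : ℝ) * Bh := by ring
  have hLm : (L : ℝ) - 1 ≤ 2 * (m : ℝ) := by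
    have h1 : L - 1 ≤ 2 * m := by omega
    have h2 : ((L - 1 : ℕ) : ℝ) ≤ ((2 * m : ℕ) : ℝ) := by exact_mod_cast h1
    have h3 : ((L - 1 : ℕ) : ℝ) = (L : ℝ) - 1 := by
      rw [Nat.cast_sub (by omega)]
      simp
    rw [h3] at h2
    push_cast at h2
    linarith
  -- (L-1) γ² Bh ≤ 4 C w
  have hfinal : ((L : ℝ) - 1) * γ ^ 2 * Bh ≤ 4 * C * (w : ℝ) := by
    rcases hBh0.eq_or_lt with h0 | hpos
    · rw [← h0, mul_zero]; positivity
    · have hm1 : (m : ℝ) * γ ^ 2 * Bh ≤ 2 * C * (w : ℝ) := by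
        have h' : (m : ℝ) * γ ^ 2 * Bh * Bh ≤ 2 * C * (w : ℝ) * Bh := by nlinarith [hmain2]
        exact le_of_mul_le_mul_right h' hpos
      have hγB : 0 ≤ γ ^ 2 * Bh := by positivity
      calc ((L : ℝ) - 1) * γ ^ 2 * Bh = ((L : ℝ) - 1) * (γ ^ 2 * Bh) := by ring
        _ ≤ (2 * (m : ℝ)) * (γ ^ 2 * Bh) := mul_le_mul_of_nonneg_right hLm hγB
        _ = 2 * ((m : ℝ) * γ ^ 2 * Bh) := by ring
        _ ≤ 2 * (2 * C * (w : ℝ)) := by linarith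
        _ = 4 * C * (w : ℝ) := by ring
  have hgoal : ((L : ℝ) - 1) * (γ * (1 - γ / T ^ 2 * A)) = ((L : ℝ) - 1) * γ ^ 2 * Bh / T ^ 2 := by
    rw [hBh]; field_simp
  rw [hgoal, div_le_div_iff₀ (by positivity) (by positivity)]
  exact mul_le_mul_of_nonneg_right hfinal (by positivity)

/-- **The crux from a bulk per-bond bound** (the line's skeleton v2, composed): if for all parameters `> 0` and
`T > 0` there are `ℓ, C ≥ 0` such that the bulk per-bond bound of `bulkFieldCeiling_of_bulkBondBound` holds for every
`ε ∈ (0,1]` with some exclusion radius `r(ε)`, then `VanishingNoiseBound` (`K = 4C(2ℓ+2)/T²`, `ε₁ = 1`).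
[cite: BernardinOlla2011, §3] -/
theorem vanishingNoiseBound_of_bulkBondBound
    (h : ∀ ω₂ lam β γ : ℝ, 0 < ω₂ → 0 < lam → 0 < β → 0 < γ → ∀ T : ℝ, 0 < T →
      ∃ (ℓ : ℕ) (C : ℝ), 0 ≤ C ∧ ∀ ε : ℝ, 0 < ε → ε ≤ 1 → ∃ r : ℕ,
        ∀ (L : ℕ), 2 ≤ L → ∀ g : PhaseSpace L → ℝ, ContDiff ℝ 2 g →
        (∃ C₀ : ℝ, ∀ u, |g u| ≤ C₀ * Real.exp (1 / (4 * T) * (pinnedChain ω₂ lam β γ).hamiltonian L u)) →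
        (∀ u, (pinnedChain ω₂ lam β γ).flipGenerator L T T ε g u = -(kin L 0 u - T)) →
        ∀ i : Fin L, r + ℓ + 1 ≤ i.val → i.val + ℓ + r + 3 ≤ L →
        (∫ u, g u * (pinnedChain ω₂ lam β γ).bondCurrent L i u
            ∂((pinnedChain ω₂ lam β γ).gibbsMeasure L T)) ^ 2 ≤
          C * ε * ∑ x : Fin L, if i.val - ℓ ≤ x.val ∧ x.val ≤ i.val + 1 + ℓ then
              ∫ u, (g (momentumFlip x u) - g u) ^ 2 ∂((pinnedChain ω₂ lam β γ).gibbsMeasure L T) else 0) :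
    Theses.VanishingNoiseTransfer.VanishingNoiseBound := by
  refine vanishingNoiseBound_of_bulkFieldCeiling fun ω₂ lam β γ T hω hl hβ hγ hT => ?_
  obtain ⟨ℓ, C, hC0, hB⟩ := h ω₂ lam β γ hω hl hβ hγ T hT
  exact ⟨4 * C * ((2 * ℓ + 2 : ℕ) : ℝ) / T ^ 2, bulkFieldCeiling_of_bulkBondBound hω hl hβ hγ hT hC0 hB⟩

end PerBond

/-! ## Registered helper sub-goal (stub form, one line) -/

/-- Registered helper sub-goal `helper_vanishingNoiseBoundOfBulkFieldCeiling` of crux stmt-AtomisticToContinuum-11976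
(= `vanishingNoiseBound_of_bulkFieldCeiling` in stub form): an ε-uniform bulk field ceiling with ε-dependent admissible
length implies `VanishingNoiseBound`. [cite: BernardinOlla2011, §3] -/
theorem helper_vanishingNoiseBoundOfBulkFieldCeiling : (∀ (ω₂ lam β γ T : ℝ), 0 < ω₂ → 0 < lam → 0 < β → 0 < γ → 0 < T → ∃ K : ℝ, ∀ ε : ℝ, 0 < ε → ε ≤ 1 → ∃ L₀ : ℕ, ∀ (L : ℕ), L₀ ≤ L → 2 ≤ L → ∀ g : Literature.MathematicalPhysics.KineticTheory.HeatConduction.PhaseSpace L → ℝ, ContDiff ℝ 2 g → (∃ C₀ : ℝ, ∀ u, |g u| ≤ C₀ * Real.exp (1 / (4 * T) * (Literature.MathematicalPhysics.KineticTheory.HeatConduction.pinnedChain ω₂ lam β γ).hamiltonian L u)) → (∀ u, (Literature.MathematicalPhysics.KineticTheory.HeatConduction.pinnedChain ω₂ lam β γ).flipGenerator L T T ε g u = -(Summit.AtomisticToContinuum.FouriersLaw.Theorems.SuperadditiveResistance.DeviceLiouville.kin L 0 u - T)) → ((L : ℝ) - 1) * (γ * (1 - γ / T ^ 2 * MeasureTheory.integral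 ((Literature.MathematicalPhysics.KineticTheory.HeatConduction.pinnedChain ω₂ lam β γ).gibbsMeasure L T) (fun u => g u * (Summit.AtomisticToContinuum.FouriersLaw.Theorems.SuperadditiveResistance.DeviceLiouville.kin L 0 u - T)))) ≤ K) → Summit.AtomisticToContinuum.FouriersLaw.Theses.VanishingNoiseTransfer.VanishingNoiseBound :=
  fun hU => vanishingNoiseBound_of_bulkFieldCeiling hU

end Summit.AtomisticToContinuum.FouriersLaw.Theorems.VanishingNoiseBound

end
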